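import Summits.AtomisticToContinuum.BoseEinsteinCondensation.Theses.BECHusimiAmplitudeGas
import Summits.AtomisticToContinuum.BoseEinsteinCondensation.Theorems.BECHusimiAmplitudeGasPositivityReductionShiftedModulus
import Summits.AtomisticToContinuum.BoseEinsteinCondensation.Theorems.BECHusimiAmplitudeGasPositivityReduction
import Literature.MathematicalPhysics.QuantumManyBody.CondensateOccupationStability
import HarnessLib

/-!
# Route BECHusimiAmplitudeGas — the node `PeriodicBECNonneg` (item stmt-AtomisticToContinuum-11996):
# the sign condition is a choice of functional, not of states

Helper file (`--supports stmt-AtomisticToContinuum-11996`). The node asks constant-mode BEC,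
`n₀(Ψ) ≥ cN`, only of the periodic `δ`-near-minimisers `Ψ` that are POINTWISE NONNEGATIVE reals.
Here we show that this side condition can be traded for the functional: the node is EQUIVALENT to
the sign-free statement "every periodic `δ`-near-minimiser `Ψ` (complex, any sign) has
`n₀(|Ψ|) ≥ cN`", where `|Ψ| : X ↦ ‖Ψ X‖` is the modulus (`periodicBECNonneg_iff_modulus`).

* `condensateOccupation_ofReal_mono` — `0 ≤ f ≤ g` pointwise (real, continuous) gives
  `n₀(f) ≤ n₀(g)`: the constant mode is a nonnegative function, so `Y ↦ ∫_cell f(·,Y)` is monotone.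
* `condensateOccupation_le_modulus` — `n₀(Ψ) ≤ n₀(|Ψ|)` (triangle inequality in the slice integral);
  hence the unsigned periodic-BEC statement implies the modulus form box by box
  (`modulus_of_unsigned_at`), the cheap direction of the chain
  `PeriodicBEC ⇒ (modulus form) ⇔ PeriodicBECNonneg` (and, for bounded `v`, `PeriodicBECNonneg ⇒
  PeriodicBEC` is `positivityReduction_of_bounded`).
* `exists_shiftedModulus_companion` — for a GIVEN periodic trial state `Ψ` and `0 < κ < 1`: a
  nonnegative periodic trial state `Φ = I^{-1/2}(√(|Ψ|²+η²) - η)` with `1 - κ ≤ I ≤ 1`,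
  `n₀(Φ) ≤ I⁻¹ n₀(|Ψ|)` and `periodicEnergy v Φ ≤ I⁻¹ periodicEnergy v Ψ` for EVERY `v` (hard cores
  included: `0 ≤ Φ√I ≤ |Ψ|`, smooth diamagnetic inequality of part 4 of `PositivityReduction`).
* `modulus_transfer_at`, `periodicBECNonneg_iff_modulus` — the equivalence (constant `c ↦ c/2`,
  slack `δ ↦ min δ 1 / 2`; the case `E₀ = ⊤` is separate and trivial since then every state is a
  near-minimiser).
* `hasGroundStateBEC_of_periodicBECNonneg_of_bounded` — what the node buys downstream today: with
  the shared crux `BoundaryTransferWeak`, the conjunct's `HasGroundStateBEC v ρ` at all small `ρ`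
  for every BOUNDED repulsive finite-range `v` (through `positivityReduction_of_bounded`).
-/

noncomputable section

open MeasureTheory Filter Set Complex
open scoped ENNReal NNReal Topology ComplexConjugate

namespace Summit.AtomisticToContinuum.BoseEinsteinCondensation.Theorems

open Literature.MathematicalPhysics.QuantumManyBody.BoseGas Literature.MathematicalPhysics.QuantumManyBody
open Summit.AtomisticToContinuum.BoseEinsteinCondensation.Theses.BECHusimiAmplitudeGas

variable {N : ℕ} {L : ℝ}

/-! ### Monotonicity of the constant-mode occupation on nonnegative functions -/

/-- `‖(r : ℂ)‖₊² = ofReal (r²)` in `ℝ≥0∞` (private copy). [folklore] -/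
private theorem ennnorm_sq_ofReal_pm (r : ℝ) : ((‖(r : ℂ)‖₊ : ℝ≥0∞)) ^ 2 = ENNReal.ofReal (r ^ 2) := by
  rw [coe_nnnorm_sq_eq_ofReal, Complex.norm_real, Real.norm_eq_abs, sq_abs]

/-- **Monotonicity of `n₀` on nonnegative real functions.** If `0 ≤ f ≤ g` pointwise for continuous
real functions on configuration space, then `n₀(f) ≤ n₀(g)` (read in `ℂ`): by
`n₀ = N L⁻³ ∫_{cell^{N-1}} |∫_cell f(x,Y) dx|² dY` and `0 ≤ ∫_cell f(·,Y) ≤ ∫_cell g(·,Y)`.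
[folklore] -/
theorem condensateOccupation_ofReal_mono (hL : 0 < L) {f g : Config N → ℝ} (hf : Continuous f)
    (hg : Continuous g) (hf0 : ∀ X, 0 ≤ f X) (hfg : ∀ X, f X ≤ g X) :
    condensateOccupation N L (fun X => ((f X : ℝ) : ℂ)) ≤
      condensateOccupation N L (fun X => ((g X : ℝ) : ℂ)) := by
  cases N with
  | zero => simp [condensateOccupation, occupation]
  | succ n =>
    rw [condensateOccupation_succ hL, condensateOccupation_succ hL]
    refine mul_le_mul' le_rfl (mul_le_mul' le_rfl (lintegral_mono fun Y => ?_))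
    dsimp only
    -- the slice integrals are real, nonnegative and ordered
    have hfc : Continuous fun x : Space => f (Matrix.vecCons x Y) :=
      hf.comp (continuous_id.matrixVecCons continuous_const)
    have hgc : Continuous fun x : Space => g (Matrix.vecCons x Y) :=
      hg.comp (continuous_id.matrixVecCons continuous_const)
    have hfi : IntegrableOn (fun x : Space => f (Matrix.vecCons x Y)) (cell L) volume :=
      integrableOn_cell hfc
    have hgi : IntegrableOn (fun x : Space => g (Matrix.vecCons x Y)) (cell L) volume :=
      integrableOn_cell hgc
    have hF : ∫ x in cell L, ((f (Matrix.vecCons x Y) : ℝ) : ℂ) =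
        ((∫ x in cell L, f (Matrix.vecCons x Y) : ℝ) : ℂ) := integral_ofReal
    have hG : ∫ x in cell L, ((g (Matrix.vecCons x Y) : ℝ) : ℂ) =
        ((∫ x in cell L, g (Matrix.vecCons x Y) : ℝ) : ℂ) := integral_ofReal
    have h0 : 0 ≤ ∫ x in cell L, f (Matrix.vecCons x Y) :=
      setIntegral_nonneg (measurableSet_cell L) fun x _ => hf0 _
    have hle : ∫ x in cell L, f (Matrix.vecCons x Y) ≤ ∫ x in cell L, g (Matrix.vecCons x Y) :=
      setIntegral_mono hfi hgi fun x => hfg _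
    rw [hF, hG, ennnorm_sq_ofReal_pm, ennnorm_sq_ofReal_pm]
    exact ENNReal.ofReal_le_ofReal (pow_le_pow_left₀ h0 hle 2)

/-- **The modulus does not decrease the condensate**: `n₀(Ψ) ≤ n₀(|Ψ|)` for a continuous `Ψ`, where
`|Ψ| : X ↦ ‖Ψ X‖` (triangle inequality `|∫_cell Ψ(x,Y) dx| ≤ ∫_cell |Ψ(x,Y)| dx` in every slice).
[folklore] -/
theorem condensateOccupation_le_modulus (hL : 0 < L) {Ψ : Config N → ℂ} (hΨ : Continuous Ψ) :
    condensateOccupation N L Ψ ≤ condensateOccupation N L (fun X => ((‖Ψ X‖ : ℝ) : ℂ)) := by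
  cases N with
  | zero => simp [condensateOccupation, occupation]
  | succ n =>
    rw [condensateOccupation_succ hL, condensateOccupation_succ hL]
    refine mul_le_mul' le_rfl (mul_le_mul' le_rfl (lintegral_mono fun Y => ?_))
    dsimp only
    have hG : ∫ x in cell L, (((‖Ψ (Matrix.vecCons x Y)‖ : ℝ)) : ℂ) =
        ((∫ x in cell L, ‖Ψ (Matrix.vecCons x Y)‖ : ℝ) : ℂ) := integral_ofReal
    have h0 : 0 ≤ ∫ x in cell L, ‖Ψ (Matrix.vecCons x Y)‖ :=
      setIntegral_nonneg (measurableSet_cell L) fun x _ => norm_nonneg _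
    have hle : ‖∫ x in cell L, Ψ (Matrix.vecCons x Y)‖ ≤ ∫ x in cell L, ‖Ψ (Matrix.vecCons x Y)‖ :=
      norm_integral_le_integral_norm _
    rw [hG, coe_nnnorm_sq_eq_ofReal, ennnorm_sq_ofReal_pm]
    exact ENNReal.ofReal_le_ofReal (pow_le_pow_left₀ (norm_nonneg _) hle 2)

/-- For a pointwise nonnegative real state the modulus is the state itself. [folklore] -/
theorem modulus_eq_self_of_nonneg {Ψ : Config N → ℂ} (hΨ : ∀ X, Ψ X = ((‖Ψ X‖ : ℝ) : ℂ)) :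
    (fun X => ((‖Ψ X‖ : ℝ) : ℂ)) = Ψ :=
  funext fun X => (hΨ X).symm

/-! ### The shifted-modulus companion of a given state -/

/-- **Shifted-modulus companion with quantitative control.** For `L > 0`, a periodic `C¹` Bose
trial state `Ψ` and `0 < κ < 1` there are a periodic `C¹` Bose trial state `Φ`, pointwise a
nonnegative real, and `I ∈ (0, 1]` with `1 ≤ I + κ`, such that
`n₀(Φ) ≤ I⁻¹ · n₀(|Ψ|)` and `periodicEnergy v Φ ≤ I⁻¹ · periodicEnergy v Ψ` for EVERY pair potential
`v : ℝ → [0, ∞]`. Construction: `Φ = I^{-1/2} f`, `f = √(|Ψ|² + η²) - η`, `η = κ/(1 + L^{3N})`,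
`I = ‖f‖²_cell`; `0 ≤ f ≤ |Ψ|`, `|∇f| ≤ |∇Ψ|`, `|Ψ|² ≤ f² + η(|Ψ|² + 1)`. [folklore] -/
theorem exists_shiftedModulus_companion (hL : 0 < L) (Ψ : PeriodicTrialState N L) {κ : ℝ≥0}
    (hκ0 : 0 < κ) (hκ1 : κ < 1) :
    ∃ Φ : PeriodicTrialState N L, ∃ I : ℝ≥0∞, I ≠ 0 ∧ I ≤ 1 ∧ 1 ≤ I + κ ∧
      (∀ X, Φ.ψ X = ((‖Φ.ψ X‖ : ℝ) : ℂ)) ∧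
      condensateOccupation N L Φ.ψ ≤
        I⁻¹ * condensateOccupation N L (fun X => ((‖Ψ.ψ X‖ : ℝ) : ℂ)) ∧
      ∀ v : ℝ → ℝ≥0∞, periodicEnergy v Φ ≤ I⁻¹ * periodicEnergy v Ψ := by
  -- the parameter `η = κ/(1 + V)`
  set V : ℝ := (L ^ 3) ^ N with hV
  have hV0 : 0 < V := by positivity
  set η : ℝ := (κ : ℝ) / (1 + V) with hη
  have hκ0' : (0 : ℝ) < κ := by exact_mod_cast hκ0
  have hη0 : 0 < η := div_pos hκ0' (by positivity)
  have hηκ : ENNReal.ofReal (η * (1 + V)) = (κ : ℝ≥0∞) := by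
    rw [hη, div_mul_cancel₀ _ (by positivity), ENNReal.ofReal_coe_nnreal]
  have hκ1' : (κ : ℝ≥0∞) < 1 := by exact_mod_cast hκ1
  -- the shifted modulus
  obtain ⟨f, hf⟩ : ∃ f : Config N → ℝ, f = fun X => Real.sqrt (‖Ψ.ψ X‖ ^ 2 + η ^ 2) - η := ⟨_, rfl⟩
  have hf0 : ∀ X, 0 ≤ f X := fun X => by rw [hf]; exact shiftedModulus_nonneg _ hη0.le
  have hfle : ∀ X, f X ≤ ‖Ψ.ψ X‖ := fun X => by rw [hf]; exact shiftedModulus_le (norm_nonneg _) hη0.le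
  have hfC : ContDiff ℝ 1 f := by
    rw [hf]
    exact (((Ψ.contDiff.norm_sq ℂ).add contDiff_const).sqrt fun X => by positivity).sub contDiff_const
  have huC : ContDiff ℝ 1 fun X => ((f X : ℝ) : ℂ) := Complex.ofRealCLM.contDiff.comp hfC
  have huper : ∀ (X : Config N) (i : Fin N) (k : Fin 3),
      ((f (X + Pi.single i (EuclideanSpace.single k L)) : ℝ) : ℂ) = ((f X : ℝ) : ℂ) := fun X i k => by
    simp only [hf, Ψ.periodic]
  have husymm : ∀ (σ : Equiv.Perm (Fin N)) (X : Config N), ((f (X ∘ σ) : ℝ) : ℂ) = ((f X : ℝ) : ℂ) :=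
    fun σ X => by simp only [hf, Ψ.symm]
  -- pointwise comparisons in `ℝ≥0∞`
  have hsq_le : ∀ X, ((‖((f X : ℝ) : ℂ)‖₊ : ℝ≥0∞)) ^ 2 ≤ ((‖Ψ.ψ X‖₊ : ℝ≥0∞)) ^ 2 := fun X => by
    rw [ennnorm_sq_ofReal_pm, coe_nnnorm_sq_eq_ofReal]
    exact ENNReal.ofReal_le_ofReal (pow_le_pow_left₀ (hf0 X) (hfle X) 2)
  have hsq_ge : ∀ X, ((‖Ψ.ψ X‖₊ : ℝ≥0∞)) ^ 2 ≤
      ((‖((f X : ℝ) : ℂ)‖₊ : ℝ≥0∞)) ^ 2 + ENNReal.ofReal η * (((‖Ψ.ψ X‖₊ : ℝ≥0∞)) ^ 2 + 1) := by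
    intro X
    rw [ennnorm_sq_ofReal_pm, coe_nnnorm_sq_eq_ofReal, ← ENNReal.ofReal_one,
      ← ENNReal.ofReal_add (by positivity) zero_le_one, ← ENNReal.ofReal_mul hη0.le,
      ← ENNReal.ofReal_add (by positivity) (by positivity)]
    refine ENNReal.ofReal_le_ofReal ?_
    have h := sq_le_shiftedModulus_sq_add ‖Ψ.ψ X‖ hη0.le
    rw [hf]
    exact h
  -- the cell norm `I` of `f`: `I ≤ 1`, `1 ≤ I + κ`
  set I : ℝ≥0∞ := ∫⁻ X in cellN N L, ((‖((f X : ℝ) : ℂ)‖₊ : ℝ≥0∞)) ^ 2 with hI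
  have hmeasΨ : Measurable fun X => ((‖Ψ.ψ X‖₊ : ℝ≥0∞)) ^ 2 :=
    (Ψ.contDiff.continuous.measurable.nnnorm.coe_nnreal_ennreal).pow_const 2
  have hI1 : I ≤ 1 := by
    calc I ≤ ∫⁻ X in cellN N L, ((‖Ψ.ψ X‖₊ : ℝ≥0∞)) ^ 2 := lintegral_mono fun X => hsq_le X
      _ = 1 := Ψ.norm_eq
  have hItop : I ≠ ⊤ := ne_top_of_le_ne_top ENNReal.one_ne_top hI1
  have hIκ : 1 ≤ I + κ := by
    calc (1 : ℝ≥0∞) = ∫⁻ X in cellN N L, ((‖Ψ.ψ X‖₊ : ℝ≥0∞)) ^ 2 := Ψ.norm_eq.symm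
      _ ≤ ∫⁻ X in cellN N L, ((‖((f X : ℝ) : ℂ)‖₊ : ℝ≥0∞)) ^ 2 +
            ENNReal.ofReal η * (((‖Ψ.ψ X‖₊ : ℝ≥0∞)) ^ 2 + 1) := lintegral_mono fun X => hsq_ge X
      _ = I + ENNReal.ofReal η * (1 + ENNReal.ofReal V) := by
          have hm1 : Measurable fun X => ((‖Ψ.ψ X‖₊ : ℝ≥0∞)) ^ 2 + 1 := hmeasΨ.add measurable_const
          have hm2 : Measurable fun X => ENNReal.ofReal η * (((‖Ψ.ψ X‖₊ : ℝ≥0∞)) ^ 2 + 1) :=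
            hm1.const_mul _
          rw [lintegral_add_right _ hm2, lintegral_const_mul _ hm1, lintegral_add_right _ measurable_const,
            Ψ.norm_eq, setLIntegral_const, volume_cellN, one_mul, ← ENNReal.ofReal_pow hL.le,
            ← ENNReal.ofReal_pow (by positivity)]
      _ = I + κ := by
          rw [← ENNReal.ofReal_one, ← ENNReal.ofReal_add zero_le_one hV0.le, ← ENNReal.ofReal_mul hη0.le,
            hηκ]
  have hI0 : I ≠ 0 := by
    intro h0
    rw [h0, zero_add] at hIκ
    exact absurd hκ1' (not_lt.2 hIκ)
  -- normalise: `Φ = a f`, `a = ‖f‖⁻¹_cell > 0`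
  have hIpos : 0 < I.toReal := ENNReal.toReal_pos hI0 hItop
  set a : ℝ := (Real.sqrt I.toReal)⁻¹ with ha
  have ha0 : 0 < a := by positivity
  have ha2 : ((‖(a : ℂ)‖₊ : ℝ≥0∞)) ^ 2 = I⁻¹ := by
    rw [ennnorm_sq_ofReal_pm, ha, inv_pow, Real.sq_sqrt hIpos.le, ENNReal.ofReal_inv_of_pos hIpos,
      ENNReal.ofReal_toReal hItop]
  let Φ : PeriodicTrialState N L :=
    { ψ := fun X => (a : ℂ) * ((f X : ℝ) : ℂ)
      contDiff := contDiff_const.mul huC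
      periodic := fun X i k => by simp only [huper]
      symm := fun σ X => by simp only [husymm]
      norm_eq := by
        rw [lintegral_cellN_sq_const_mul, ha2, ENNReal.inv_mul_cancel hI0 hItop] }
  refine ⟨Φ, I, hI0, hI1, hIκ, fun X => ?_, ?_, fun v => ?_⟩
  · -- nonnegativity
    show (a : ℂ) * ((f X : ℝ) : ℂ) = ((‖(a : ℂ) * ((f X : ℝ) : ℂ)‖ : ℝ) : ℂ)
    rw [← Complex.ofReal_mul, Complex.norm_real, Real.norm_of_nonneg (mul_nonneg ha0.le (hf0 X))]
  · -- the occupation: `n₀(a f) = a² n₀(f) ≤ I⁻¹ n₀(|Ψ|)`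
    show condensateOccupation N L (fun X => (a : ℂ) * ((f X : ℝ) : ℂ)) ≤ _
    rw [Literature.MathematicalPhysics.QuantumManyBody.BoseGas.condensateOccupation_const_mul, ha2]
    exact mul_le_mul' le_rfl
      (condensateOccupation_ofReal_mono hL hfC.continuous Ψ.contDiff.continuous.norm hf0 hfle)
  · -- the energy: `periodicEnergy v Φ = I⁻¹ q(f) ≤ I⁻¹ periodicEnergy v Ψ`
    have hq : (∫⁻ X in cellN N L, kineticDensity (fun Y => ((f Y : ℝ) : ℂ)) X +
        periodicInteraction v L X * ((‖((f X : ℝ) : ℂ)‖₊ : ℝ≥0∞)) ^ 2) ≤ periodicEnergy v Ψ := by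
      refine lintegral_mono fun X => add_le_add ?_ (mul_le_mul' le_rfl (hsq_le X))
      rw [hf]
      exact kineticDensity_shiftedModulus_le (Ψ.contDiff.differentiable one_ne_zero) hη0 X
    have hEΦ : periodicEnergy v Φ = I⁻¹ * ∫⁻ X in cellN N L, kineticDensity (fun Y => ((f Y : ℝ) : ℂ)) X +
        periodicInteraction v L X * ((‖((f X : ℝ) : ℂ)‖₊ : ℝ≥0∞)) ^ 2 := by
      rw [← ha2]
      exact lintegral_periodicEnergy_const_mul v L (a : ℂ) huC
    rw [hEΦ]
    gcongr

/-! ### The node in modulus form -/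

/-- The transfer at one box: if every NONNEGATIVE `δ₁`-near-minimiser has `n₀ ≥ cN`, then with
`δ = min δ₁ 1 / 2` (any `δ`, say `1`, if `E₀ = ⊤`) every `δ`-near-minimiser `Ψ` has
`n₀(|Ψ|) ≥ (c/2)N` — fire the hypothesis on the shifted-modulus companion `Φ` of `Ψ` (`κ` so small
that `Φ` is a `δ₁`-near-minimiser and `κ ≤ 1/2`) and use `n₀(Φ) ≤ I⁻¹ n₀(|Ψ|)`, `I ≥ 1 - κ ≥ 1/2`.
[folklore] -/
theorem modulus_transfer_at (v : ℝ → ℝ≥0∞) (hL : 0 < L) {c : ℝ} {δ₁ : ℝ≥0∞}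
    (hδ₁ : 0 < δ₁)
    (hnn : ∀ Φ : PeriodicTrialState N L, periodicEnergy v Φ ≤ periodicGroundStateEnergy v N L + δ₁ →
      (∀ X, Φ.ψ X = ((‖Φ.ψ X‖ : ℝ) : ℂ)) → ENNReal.ofReal (c * N) ≤ condensateOccupation N L Φ.ψ) :
    ∃ δ : ℝ≥0∞, 0 < δ ∧ ∀ Ψ : PeriodicTrialState N L,
      periodicEnergy v Ψ ≤ periodicGroundStateEnergy v N L + δ →
        ENNReal.ofReal (c / 2 * N) ≤ condensateOccupation N L (fun X => ((‖Ψ.ψ X‖ : ℝ) : ℂ)) := by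
  set E₀ := periodicGroundStateEnergy v N L with hE₀
  -- the common final step: from a companion with `κ ≤ 1/2` which is a `δ₁`-near-minimiser
  have key : ∀ (Ψ Φ : PeriodicTrialState N L) (I : ℝ≥0∞) (κ : ℝ≥0), (κ : ℝ≥0∞) ≤ 1 / 2 →
      I ≠ 0 → I ≤ 1 → 1 ≤ I + κ → (∀ X, Φ.ψ X = ((‖Φ.ψ X‖ : ℝ) : ℂ)) →
      condensateOccupation N L Φ.ψ ≤ I⁻¹ * condensateOccupation N L (fun X => ((‖Ψ.ψ X‖ : ℝ) : ℂ)) →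
      periodicEnergy v Φ ≤ E₀ + δ₁ →
      ENNReal.ofReal (c / 2 * N) ≤ condensateOccupation N L (fun X => ((‖Ψ.ψ X‖ : ℝ) : ℂ)) := by
    intro Ψ Φ I κ hκ hI0 hI1 hIκ hΦnn hocc hΦE
    have hItop : I ≠ ⊤ := ne_top_of_le_ne_top ENNReal.one_ne_top hI1
    have h1 : ENNReal.ofReal (c * N) ≤ I⁻¹ * condensateOccupation N L (fun X => ((‖Ψ.ψ X‖ : ℝ) : ℂ)) :=
      (hnn Φ hΦE hΦnn).trans hocc
    -- multiply by `I`: `I · ofReal (cN) ≤ n₀(|Ψ|)`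
    have h2 : I * ENNReal.ofReal (c * N) ≤ condensateOccupation N L (fun X => ((‖Ψ.ψ X‖ : ℝ) : ℂ)) := by
      calc I * ENNReal.ofReal (c * N)
          ≤ I * (I⁻¹ * condensateOccupation N L (fun X => ((‖Ψ.ψ X‖ : ℝ) : ℂ))) := mul_le_mul' le_rfl h1
        _ = condensateOccupation N L (fun X => ((‖Ψ.ψ X‖ : ℝ) : ℂ)) := by
            rw [← mul_assoc, ENNReal.mul_inv_cancel hI0 hItop, one_mul]
    -- `1/2 ≤ I` from `1 ≤ I + κ`, `κ ≤ 1/2`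
    have hIhalf : (1 / 2 : ℝ≥0∞) ≤ I := by
      have h3 : (1 / 2 : ℝ≥0∞) + 1 / 2 ≤ I + 1 / 2 := by
        calc (1 / 2 : ℝ≥0∞) + 1 / 2 = 1 := ENNReal.add_halves 1
          _ ≤ I + κ := hIκ
          _ ≤ I + 1 / 2 := add_le_add le_rfl hκ
      exact (ENNReal.add_le_add_iff_right (ENNReal.div_ne_top ENNReal.one_ne_top two_ne_zero)).1 h3
    calc ENNReal.ofReal (c / 2 * N) = 1 / 2 * ENNReal.ofReal (c * N) := by
          rw [show c / 2 * (N : ℝ) = 1 / 2 * (c * N) by ring, ENNReal.ofReal_mul (by norm_num),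
            ENNReal.ofReal_div_of_pos two_pos, ENNReal.ofReal_one, ENNReal.ofReal_ofNat]
      _ ≤ I * ENNReal.ofReal (c * N) := mul_le_mul' hIhalf le_rfl
      _ ≤ _ := h2
  by_cases hE : E₀ = ⊤
  · -- every state is a `δ₁`-near-minimiser
    refine ⟨1, one_pos, fun Ψ _ => ?_⟩
    have hhalf0 : (0 : ℝ≥0) < 1 / 2 := by norm_num
    have hhalf1 : (1 / 2 : ℝ≥0) < 1 := by norm_num
    obtain ⟨Φ, I, hI0, hI1, hIκ, hΦnn, hocc, hen⟩ := exists_shiftedModulus_companion hL Ψ hhalf0 hhalf1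
    refine key Ψ Φ I (1 / 2) (le_of_eq ?_) hI0 hI1 hIκ hΦnn hocc ?_
    · rw [ENNReal.coe_div two_ne_zero, ENNReal.coe_one, ENNReal.coe_ofNat]
    · rw [hE, top_add]; exact le_top
  · -- finite ground-state energy: slack `δ = δ'/2`, `δ' = min δ₁ 1`
    set δ' : ℝ≥0∞ := min δ₁ 1 with hδ'
    have hδ'0 : 0 < δ' := lt_min hδ₁ one_pos
    have hδ'top : δ' ≠ ⊤ := ne_top_of_le_ne_top ENNReal.one_ne_top (min_le_right _ _)
    set B : ℝ≥0∞ := E₀ + δ' with hB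
    have hBtop : B ≠ ⊤ := ENNReal.add_ne_top.2 ⟨hE, hδ'top⟩
    have hδ2 : δ' / 2 ≠ 0 := (ENNReal.half_pos hδ'0.ne').ne'
    have hδ2top : δ' / 2 ≠ ⊤ := ENNReal.div_ne_top hδ'top two_ne_zero
    obtain ⟨κ₀, hκ₀0, hκ₀⟩ := ENNReal.exists_nnreal_pos_mul_lt hBtop hδ2
    set κ : ℝ≥0 := min κ₀ (1 / 2) with hκ
    have hκpos : 0 < κ := lt_min hκ₀0 (by norm_num)
    have hκ1 : κ < 1 := (min_le_right _ _).trans_lt (by norm_num)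
    have hκhalf : (κ : ℝ≥0∞) ≤ 1 / 2 := by
      have : (κ : ℝ≥0∞) ≤ ((1 / 2 : ℝ≥0) : ℝ≥0∞) := ENNReal.coe_le_coe.2 (min_le_right _ _)
      rwa [ENNReal.coe_div two_ne_zero, ENNReal.coe_one, ENNReal.coe_ofNat] at this
    have hκB : (κ : ℝ≥0∞) * B < δ' / 2 :=
      (mul_le_mul' (ENNReal.coe_le_coe.2 (min_le_left _ _)) le_rfl).trans_lt hκ₀
    refine ⟨δ' / 2, ENNReal.half_pos hδ'0.ne', fun Ψ hΨ => ?_⟩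
    obtain ⟨Φ, I, hI0, hI1, hIκ, hΦnn, hocc, hen⟩ := exists_shiftedModulus_companion hL Ψ hκpos hκ1
    have hItop : I ≠ ⊤ := ne_top_of_le_ne_top ENNReal.one_ne_top hI1
    refine key Ψ Φ I κ hκhalf hI0 hI1 hIκ hΦnn hocc ?_
    -- `periodicEnergy v Φ ≤ I⁻¹ (E₀ + δ'/2) ≤ E₀ + δ' ≤ E₀ + δ₁`
    refine (hen v).trans ?_
    refine (mul_le_mul' le_rfl hΨ).trans ?_
    rw [ENNReal.inv_mul_le_iff hI0 hItop]
    refine le_trans ?_ ((mul_le_mul' le_rfl (add_le_add le_rfl (min_le_left δ₁ 1))).trans_eq rfl)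
    -- `E₀ + δ'/2 ≤ I B`: from `B ≤ (I + κ) B = I B + κ B < I B + δ'/2`
    have h1 : E₀ + δ' / 2 + δ' / 2 ≤ I * B + κ * B := by
      calc E₀ + δ' / 2 + δ' / 2 = B := by rw [add_assoc, ENNReal.add_halves]
        _ = 1 * B := (one_mul _).symm
        _ ≤ (I + κ) * B := mul_le_mul' hIκ le_rfl
        _ = I * B + κ * B := add_mul _ _ _
    have h2 : E₀ + δ' / 2 + δ' / 2 < I * B + δ' / 2 := h1.trans_lt (ENNReal.add_lt_add_left
      (ENNReal.mul_ne_top hItop hBtop) hκB)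
    exact ((ENNReal.add_lt_add_iff_right hδ2top).1 h2).le

/-- **The node `PeriodicBECNonneg` is equivalent to its sign-free modulus form.** Constant-mode BEC
for the NONNEGATIVE periodic near-minimisers (item stmt-AtomisticToContinuum-11996 of route
`BECHusimiAmplitudeGas`) holds iff the modulus `|Ψ| : X ↦ ‖Ψ X‖` of EVERY periodic near-minimiser
`Ψ` (complex-valued, no sign condition) condenses in the constant mode, with the node's own
quantifier pattern `∀ v ∃ ρ₀ ∀ ρ < ρ₀ ∃ c > 0 ∀ᶠ N ∃ δ > 0 ∀ Ψ`. So the sign hypothesis of the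
node is a choice of the functional `Ψ ↦ n₀(|Ψ|)`, not a restriction of the class of
near-minimisers. (`⇒`: `modulus_transfer_at`, constant `c/2`; `⇐`: a nonnegative state is its own
modulus. Since `n₀(Ψ) ≤ n₀(|Ψ|)` (`condensateOccupation_le_modulus`), the unsigned periodic-BEC
statement implies both.) [folklore] -/
theorem periodicBECNonneg_iff_modulus :
    PeriodicBECNonneg ↔
      ∀ v : ℝ → ℝ≥0∞, IsRepulsiveFiniteRange v → ∃ ρ₀ : ℝ, 0 < ρ₀ ∧ ∀ ρ : ℝ, 0 < ρ → ρ < ρ₀ →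
        ∃ c : ℝ, 0 < c ∧ ∀ᶠ N : ℕ in atTop, ∃ δ : ℝ≥0∞, 0 < δ ∧
          ∀ Ψ : PeriodicTrialState N (sideLength ρ N),
            periodicEnergy v Ψ ≤ periodicGroundStateEnergy v N (sideLength ρ N) + δ →
              ENNReal.ofReal (c * N) ≤
                condensateOccupation N (sideLength ρ N) (fun X => ((‖Ψ.ψ X‖ : ℝ) : ℂ)) := by
  constructor
  · intro h v hv
    obtain ⟨ρ₀, hρ₀, H⟩ := h v hv
    refine ⟨ρ₀, hρ₀, fun ρ hρ hρlt => ?_⟩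
    obtain ⟨c, hc, hev⟩ := H ρ hρ hρlt
    refine ⟨c / 2, half_pos hc, ?_⟩
    filter_upwards [hev, eventually_gt_atTop 0] with N hN hN0
    obtain ⟨δ₁, hδ₁, hnn⟩ := hN
    have hL : 0 < sideLength ρ N := Real.rpow_pos_of_pos (div_pos (Nat.cast_pos.2 hN0) hρ) _
    exact modulus_transfer_at v hL hδ₁ hnn
  · intro h v hv
    obtain ⟨ρ₀, hρ₀, H⟩ := h v hv
    refine ⟨ρ₀, hρ₀, fun ρ hρ hρlt => ?_⟩
    obtain ⟨c, hc, hev⟩ := H ρ hρ hρlt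
    refine ⟨c, hc, ?_⟩
    filter_upwards [hev] with N ⟨δ, hδ, hΨ⟩
    refine ⟨δ, hδ, fun Ψ hE hpos => ?_⟩
    have h1 := hΨ Ψ hE
    rwa [modulus_eq_self_of_nonneg hpos] at h1

/-- **The cheap direction of positivity, at one box.** If every `δ`-near-minimiser `Ψ` has
`m ≤ n₀(Ψ)` then every `δ`-near-minimiser has `m ≤ n₀(|Ψ|)` (`n₀(Ψ) ≤ n₀(|Ψ|)`): the unsigned
periodic-BEC statement implies the modulus form of the node box by box, with the same constants.
[folklore] -/
theorem modulus_of_unsigned_at (v : ℝ → ℝ≥0∞) (hL : 0 < L) {m δ : ℝ≥0∞}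
    (h : ∀ Ψ : PeriodicTrialState N L, periodicEnergy v Ψ ≤ periodicGroundStateEnergy v N L + δ →
      m ≤ condensateOccupation N L Ψ.ψ) (Ψ : PeriodicTrialState N L)
    (hE : periodicEnergy v Ψ ≤ periodicGroundStateEnergy v N L + δ) :
    m ≤ condensateOccupation N L (fun X => ((‖Ψ.ψ X‖ : ℝ) : ℂ)) :=
  (h Ψ hE).trans (condensateOccupation_le_modulus hL Ψ.contDiff.continuous)

/-! ### What the node buys downstream, today -/

/-- **From the node to the conjunct, for bounded potentials.** Given `PeriodicBECNonneg` and the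
shared crux `BoundaryTransferWeak`, every BOUNDED repulsive finite-range pair potential `v` has
ground-state BEC in the Dirichlet box at all small densities (`HasGroundStateBEC v ρ`, the form of
the summit conjunct): `positivityReduction_of_bounded` supplies the unsigned periodic statement at
`v`, on which `BoundaryTransferWeak` fires. (Hard cores are what `PositivityReduction`,
item stmt-AtomisticToContinuum-11998, still owes.) [folklore] -/
theorem hasGroundStateBEC_of_periodicBECNonneg_of_bounded (h : PeriodicBECNonneg)
    (hBT : BoundaryTransferWeak) {v : ℝ → ℝ≥0∞} (hv : IsRepulsiveFiniteRange v)
    (hbdd : ∃ M : ℝ≥0, ∀ r, v r ≤ M) :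
    ∃ ρ₀ : ℝ, 0 < ρ₀ ∧ ∀ ρ : ℝ, 0 < ρ → ρ < ρ₀ → HasGroundStateBEC v ρ :=
  hBT v hv (positivityReduction_of_bounded h v hv hbdd)

end Summit.AtomisticToContinuum.BoseEinsteinCondensation.Theorems

end
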